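import Summits.BirchSwinnertonDyer.BirchSwinnertonDyer.Theorems.CumulativeHeegnerLeopoldtCumulativeHeegnerInclusionAtThreeStubResidualSelmerFiniteDevissage
import Summits.BirchSwinnertonDyer.BirchSwinnertonDyer.Theorems.UniversalToricDescentResidualSelmerTransport
import HarnessLib

/-!
# Route `CumulativeHeegnerLeopoldt`, crux K1 `CumulativeHeegnerInclusionAtThree` (stmt-BirchSwinnertonDyer-24198),
# line `birth` v3, STUB B1: LEFT-EXACT DÉVISSAGE OF THE RESIDUAL SELMER GROUP `R_𝔭^Σ(L, ·)` ALONG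
# `0 → A → B → C → 0` (CGLS 2022 Prop. 17, finiteness half, on the tree's named objects)

Fourth brick for stub B1 (`Sel_{𝔭′}(K_∞, E[3^∞])[3]` finite on the Leopoldt cell). By the previous bricks B1 follows from
the finiteness of the Greenberg–Vatsal residual Selmer group
`R_𝔭^Σ(L, B) = GreenbergVatsal2000.datumStrictSelmer H B p (bdpData B p 𝔭) Σ` (`L = K̄^H`, `B = E[3]`; file
`…StubResidualSelmerFiniteNamed`). Castella–Grossi–Lee–Skinner 2022 (arXiv:2008.02571 §1.4, Prop. 17) bound it, for
`E[p] ⊃ 𝔽_p(φ)` with quotient `𝔽_p(ψ)`, by the residual groups of the two CHARACTERS through the cohomology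
sequence. This file proves the finiteness half of that dévissage for an ARBITRARY `Γ_K`-equivariant exact sequence
`0 → A —j→ B —q→ C → 0` of discrete `Γ_K`-modules and an arbitrary normal `H ≤ Γ_K`:

* §1 (any topological group `G`) two injectivity criteria for `j_* : H¹(G, A) → H¹(G, B)`:
  `resH1Hom_id_injective_of_smul_eq` (`G` acts trivially on `B`: a coboundary of a trivial module is `0`) and
  `resH1Hom_id_injective_of_forall_fixed_eq_zero` (`C^G = 0`: the kernel of `j_*` is the image of `C^G` under
  the connecting map) — Serre, *Galois Cohomology* I.§2.2–2.3.
* §2 **`preimage_datumStrictSelmer_subset`**: if `j_*` is injective on the cohomology of the inertia groups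
  `H ⊓ I_v` at the good places `v ∉ Σ`, `v ∤ p` (hypothesis (U); by §1 it holds when `I_v` acts trivially on
  `B`, i.e. `B` unramified at `v`) and on the cohomology of the decomposition group `H ⊓ D_𝔭` (hypothesis (S);
  by §1 it holds when `C^{H ⊓ D_𝔭} = 0` — on the Leopoldt cell: `ψ|_{G_{K_{∞,𝔭′}}} ≠ 1`, the non-anomalous
  clause), then `j_*⁻¹(R_𝔭^Σ(L, B)) ⊆ R_𝔭^Σ(L, A)`; and
  **`finite_datumStrictSelmer_of_devissage`**: under (U), (S), `R_𝔭^Σ(L, A)` finite ∧ `R_𝔭^Σ(L, C)` finite ⟹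
  `R_𝔭^Σ(L, B)` finite (middle exactness `exists_resH1Hom_eq_of_resH1Hom_eq_zero` of the previous brick +
  functoriality `UniversalToricDescentResidualSelmer.resH1Hom_id_mem_residualSelmer` (file `…ResidualSelmerTransport`)).

With `H = ker κ`, `B = (E/K)[3]`, `A = Φ_K` (the cell's rational line base-changed to `K`), `C = E[3]/Φ_K`, this
leaves for B1 exactly: the construction of `Φ_K ↪ E[3] ↠ E[3]/Φ_K` as discrete `Γ_K`-modules and the finiteness of
the two CHARACTER residual groups `R_{𝔭′}^Σ(K_∞, 𝔽₃(φ))`, `R_{𝔭′}^Σ(K_∞, 𝔽₃(ψ))` (CGLS Thm. 11: Rubin's main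
conjecture + μ = 0, Oukhaba–Viguié 2016 at `p = 3`). THEOREMS ONLY (`--supports stmt-BirchSwinnertonDyer-24198`);
no definition, no named fact, no `sorry`; route-independent imports. Seat bsd-line-chl-k1-p1-w2 (width, stub B1).
BSD is not proved by any of this.

References: [CastellaGrossiLeeSkinner2022] Prop. 17 (arXiv:2008.02571 §1.4); [SerreGaloisCohomology1997] I.§2.2–2.3;
[GreenbergVatsal2000] §2 pp. 16–20, 26.
-/

set_option autoImplicit false
set_option linter.dupNamespace false

noncomputable section

open scoped Classical

namespace Summit.BirchSwinnertonDyer.BirchSwinnertonDyer.Theorems.CumulativeHeegnerInclusionAtThreeStubB1DevissageNamed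

open Literature.NumberTheory.EllipticCurves Literature.NumberTheory.EllipticCurves.GreenbergSelmer
  Literature.NumberTheory.EllipticCurves.GreenbergVatsal2000 Literature.NumberTheory.GaloisRepresentations
  Literature.NumberTheory.EllipticCurves.FineSelmerCoefficientMap
  NumberField IsDedekindDomain Field
  Summit.BirchSwinnertonDyer.Rank1Residual.X11b Summit.BirchSwinnertonDyer.Rank1Residual.X11b.AcSelmer
  Summit.BirchSwinnertonDyer.BirchSwinnertonDyer.Theorems.UniversalToricDescentResidualSelmer
  Summit.BirchSwinnertonDyer.BirchSwinnertonDyer.Theorems.CumulativeHeegnerInclusionAtThreeStubB1Devissage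

universe u

/-! ### §1 Two injectivity criteria for `j_* : H¹(G, A) → H¹(G, B)` -/

section Injective

variable {G : Type u} [Group G] [TopologicalSpace G] [IsTopologicalGroup G]
variable {A : Type u} [AddCommGroup A] [DistribMulAction G A] [TopologicalSpace A] [DiscreteTopology A]
variable {B : Type u} [AddCommGroup B] [DistribMulAction G B] [TopologicalSpace B] [DiscreteTopology B]
variable {C : Type u} [AddCommGroup C] [DistribMulAction G C] [TopologicalSpace C] [DiscreteTopology C]

/-- **`j_* : H¹(G, A) → H¹(G, B)` is injective when `G` acts trivially on `B`** (`j` injective): a cocycle of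
`A` that becomes a coboundary `g ↦ g b − b = 0` in `B` is `0`. (Typical use: `G` an inertia group at a place of
good reduction, `B = E[p]`.) [cite: SerreGaloisCohomology1997, I.§2.3 (cohomology of a trivial module)] -/
theorem resH1Hom_id_injective_of_smul_eq (j : A →+ B)
    (hj : ∀ (g : G) (a : A), j (ContinuousMonoidHom.id G g • a) = g • j a) (hinj : Function.Injective j)
    (htriv : ∀ (g : G) (b : B), g • b = b) :
    Function.Injective (resH1Hom (ContinuousMonoidHom.id G) j hj) := by
  rw [injective_iff_map_eq_zero]
  intro y hy
  obtain ⟨φ, rfl⟩ := oneCocycleClass_surjective _ y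
  rw [resH1Hom_id_oneCocycleClass, oneCocycleClass_eq_zero_iff] at hy
  obtain ⟨b, hb⟩ := hy
  have hb' : ∀ g : G, j (φ.1 g) = g • b - b := fun g ↦ hb g
  refine (oneCocycleClass_eq_zero_iff _ φ).mpr ⟨0, fun g ↦ ?_⟩
  change φ.1 g = g • (0 : A) - 0
  rw [smul_zero, sub_zero]
  apply hinj
  rw [hb', htriv, sub_self, map_zero]

omit [TopologicalSpace C] [DiscreteTopology C] in
/-- **`j_* : H¹(G, A) → H¹(G, B)` is injective when `C^G = 0`** for an exact `A —j→ B —q→ C` (`j` injective,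
`q ∘ j = 0`, `ker q ⊆ im j`): if `j ∘ φ = ∂b` then `q b ∈ C^G = 0`, so `b = j a` and `φ = ∂a`. (The kernel of
`j_*` is the image of `C^G` under the connecting homomorphism.) [cite: SerreGaloisCohomology1997, I.§2.2 (Prop. 2, exact sequence of cohomology)] -/
theorem resH1Hom_id_injective_of_forall_fixed_eq_zero (j : A →+ B)
    (hj : ∀ (g : G) (a : A), j (ContinuousMonoidHom.id G g • a) = g • j a) (hinj : Function.Injective j)
    (q : B →+ C) (hq : ∀ (g : G) (b : B), q (g • b) = g • q b) (hqj : ∀ a : A, q (j a) = 0)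
    (hexact : ∀ b : B, q b = 0 → ∃ a : A, j a = b) (hC : ∀ c : C, (∀ g : G, g • c = c) → c = 0) :
    Function.Injective (resH1Hom (ContinuousMonoidHom.id G) j hj) := by
  rw [injective_iff_map_eq_zero]
  intro y hy
  obtain ⟨φ, rfl⟩ := oneCocycleClass_surjective _ y
  rw [resH1Hom_id_oneCocycleClass, oneCocycleClass_eq_zero_iff] at hy
  obtain ⟨b, hb⟩ := hy
  have hb' : ∀ g : G, j (φ.1 g) = g • b - b := fun g ↦ hb g
  have hj' : ∀ (g : G) (a : A), j (g • a) = g • j a := hj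
  -- `q b` is `G`-fixed, hence `0`, hence `b = j a`
  have hfix : ∀ g : G, g • q b = q b := fun g ↦ by
    rw [← hq, ← sub_eq_zero, ← map_sub, ← hb', hqj]
  obtain ⟨a, rfl⟩ := hexact b (hC _ hfix)
  refine (oneCocycleClass_eq_zero_iff _ φ).mpr ⟨a, fun g ↦ hinj ?_⟩
  change j (φ.1 g) = j (g • a - a)
  rw [hb', map_sub, hj']

end Injective

/-! ### §2 Dévissage of `R_𝔭^Σ(L, ·)` along `0 → A → B → C → 0` -/

section Residual

variable {K : Type u} [Field K] [NumberField K] (H : Subgroup (absoluteGaloisGroup K)) [H.Normal]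
  (p : ℕ) (𝔭 : HeightOneSpectrum (𝓞 K)) (S₀ : Set (HeightOneSpectrum (𝓞 K)))

variable {A : Type u} [AddCommGroup A] [DistribMulAction (absoluteGaloisGroup K) A] [TopologicalSpace A]
  [DiscreteTopology A]
variable {B : Type u} [AddCommGroup B] [DistribMulAction (absoluteGaloisGroup K) B] [TopologicalSpace B]
  [DiscreteTopology B]
variable {C : Type u} [AddCommGroup C] [DistribMulAction (absoluteGaloisGroup K) C] [TopologicalSpace C]
  [DiscreteTopology C]

/-- **`j_*⁻¹(R_𝔭^Σ(L, B)) ⊆ R_𝔭^Σ(L, A)` under local injectivity.** For a `Γ_K`-equivariant `j : A → B` such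
that `j_*` is injective (U) on `H¹(H ⊓ I_v, ·)` for every `v ∉ Σ`, `v ∤ p`, and (S) on `H¹(H ⊓ D_𝔭, ·)`: a class
`x ∈ H¹(H, A)` with `j_* x ∈ R_𝔭^Σ(L, B)` lies in `R_𝔭^Σ(L, A)` — every defining condition of `R` is the
vanishing of a restriction of a conjugate, `j_*` commutes with conjugation and restriction
(`conjH1_comp_resH1Hom_id`, `res_inertiaIn_comp_resH1Hom_id`, `resOfLe_comp_resH1Hom_id`), and the local `j_*`
detect `0`. [cite: CastellaGrossiLeeSkinner2022, Prop. 17 (arXiv:2008.02571 §1.4)] [cite: GreenbergVatsal2000, §2 pp. 16–20] -/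
theorem preimage_datumStrictSelmer_subset (j : A →+ B)
    (hj' : ∀ (σ : absoluteGaloisGroup K) (a : A), j (σ • a) = σ • j a)
    (hU : ∀ v : HeightOneSpectrum (𝓞 K), v ∉ S₀ → ((p : ℕ) : 𝓞 K) ∉ v.asIdeal →
      Function.Injective (resH1Hom (ContinuousMonoidHom.id (inertiaIn H v)) j (fun _ a ↦ hj' _ a)))
    (hS : Function.Injective
      (resH1Hom (ContinuousMonoidHom.id ↥(H ⊓ decomp 𝔭)) j (fun _ a ↦ hj' _ a))) :
    {x : subgroupH1 H A |
        resH1Hom (ContinuousMonoidHom.id H) j (fun _ a ↦ hj' _ a) x ∈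
          datumStrictSelmer H B p (AcSelmer.bdpData B p 𝔭) S₀} ⊆
      (datumStrictSelmer H A p (AcSelmer.bdpData A p 𝔭) S₀ : Set (subgroupH1 H A)) := by
  intro x hx
  rw [Set.mem_setOf_eq, mem_datumStrictSelmer_iff, mem_unramifiedOutside_iff] at hx
  rw [SetLike.mem_coe, mem_datumStrictSelmer_iff, mem_unramifiedOutside_iff]
  set jH := resH1Hom (ContinuousMonoidHom.id H) j (fun _ a ↦ hj' _ a) with hjH
  have hconj : ∀ σ : absoluteGaloisGroup K, conjH1 H B σ (jH x) = jH (conjH1 H A σ x) := fun σ ↦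
    congrArg (fun f : subgroupH1 H A →+ subgroupH1 H B ↦ f x)
      (conjH1_comp_resH1Hom_id H j (fun _ a ↦ hj' _ a) hj' σ)
  refine ⟨fun v hvS hvp σ ↦ ?_, fun v hv σ ↦ ?_⟩
  · -- unramified at `v`
    have h := hx.1 v hvS hvp σ
    rw [hconj, GreenbergVatsal2000.unramifiedKer, AddMonoidHom.mem_ker] at h
    rw [GreenbergVatsal2000.unramifiedKer, AddMonoidHom.mem_ker]
    have e := congrArg (fun f : subgroupH1 H A →+ discreteH1 (inertiaIn H v) B ↦ f (conjH1 H A σ x))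
      (res_inertiaIn_comp_resH1Hom_id H v j (fun _ a ↦ hj' _ a) (fun _ a ↦ hj' _ a))
    simp only [AddMonoidHom.comp_apply] at e
    rw [e] at h
    exact (injective_iff_map_eq_zero _).mp (hU v hvS hvp) _ h
  · -- the condition above `p`: strict at `𝔭`, relaxed elsewhere
    by_cases hv𝔭 : v = 𝔭
    · subst hv𝔭
      have h := hx.2 v hv σ
      rw [AcSelmer.bdpData_self p v hv] at h ⊢
      rw [hconj, mem_strictKer_strictDatum_iff] at h
      rw [mem_strictKer_strictDatum_iff]
      have e := congrArg (fun f : subgroupH1 H A →+ subgroupH1 (H ⊓ decomp v) B ↦ f (conjH1 H A σ x))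
        (resOfLe_comp_resH1Hom_id (inf_le_left : H ⊓ decomp v ≤ H) j (fun _ a ↦ hj' _ a)
          (fun _ a ↦ hj' _ a))
      simp only [AddMonoidHom.comp_apply] at e
      rw [e] at h
      exact (injective_iff_map_eq_zero _).mp hS _ h
    · rw [AcSelmer.bdpData_of_ne p 𝔭 hv hv𝔭, AcSelmer.strictKer_relaxedDatum_eq_top]
      exact AddSubgroup.mem_top _

/-- **Dévissage: `R_𝔭^Σ(L, A)` and `R_𝔭^Σ(L, C)` finite ⟹ `R_𝔭^Σ(L, B)` finite**, for a `Γ_K`-equivariant exact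
`0 → A —j→ B —q→ C → 0` of discrete `Γ_K`-modules (continuous orbit maps on `B`) satisfying the local
injectivity hypotheses (U) at the good places outside `Σ` and (S) at `𝔭` of `preimage_datumStrictSelmer_subset`.
Proof: `q_*(R(B)) ⊆ R(C)` (`resH1Hom_id_mem_residualSelmer`), `j_*⁻¹(R(B)) ⊆ R(A)`, and middle exactness of
`H¹(H, A) → H¹(H, B) → H¹(H, C)` (`finite_of_finite_image_of_finite_lifts`). This is the finiteness half of
CGLS 2022 Prop. 17 on the tree's objects, for ANY reduction type. [cite: CastellaGrossiLeeSkinner2022, Prop. 17 (arXiv:2008.02571 §1.4)] [cite: SerreGaloisCohomology1997, I.§2.2] -/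
theorem finite_datumStrictSelmer_of_devissage (j : A →+ B)
    (hj' : ∀ (σ : absoluteGaloisGroup K) (a : A), j (σ • a) = σ • j a) (hinj : Function.Injective j)
    (q : B →+ C) (hq' : ∀ (σ : absoluteGaloisGroup K) (b : B), q (σ • b) = σ • q b)
    (hsurj : Function.Surjective q) (hexact : ∀ b : B, q b = 0 → ∃ a : A, j a = b)
    (hcontB : ∀ b : B, Continuous fun g : absoluteGaloisGroup K ↦ g • b)
    (hU : ∀ v : HeightOneSpectrum (𝓞 K), v ∉ S₀ → ((p : ℕ) : 𝓞 K) ∉ v.asIdeal →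
      Function.Injective (resH1Hom (ContinuousMonoidHom.id (inertiaIn H v)) j (fun _ a ↦ hj' _ a)))
    (hS : Function.Injective
      (resH1Hom (ContinuousMonoidHom.id ↥(H ⊓ decomp 𝔭)) j (fun _ a ↦ hj' _ a)))
    (hA : (datumStrictSelmer H A p (AcSelmer.bdpData A p 𝔭) S₀ : Set (subgroupH1 H A)).Finite)
    (hC : (datumStrictSelmer H C p (AcSelmer.bdpData C p 𝔭) S₀ : Set (subgroupH1 H C)).Finite) :
    (datumStrictSelmer H B p (AcSelmer.bdpData B p 𝔭) S₀ : Set (subgroupH1 H B)).Finite := by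
  have hcontH : ∀ b : B, Continuous fun g : H ↦ g • b := fun b ↦
    (hcontB b).comp continuous_subtype_val
  refine finite_of_finite_image_of_finite_lifts (G := H) j (fun _ a ↦ hj' _ a) hinj q
    (fun _ b ↦ hq' _ b) hsurj hexact hcontH (datumStrictSelmer H B p (AcSelmer.bdpData B p 𝔭) S₀) ?_ ?_
  · -- the image in `H¹(H, C)` lies in `R(C)`
    refine hC.subset ?_
    rintro _ ⟨c, hc, rfl⟩
    exact resH1Hom_id_mem_residualSelmer H p 𝔭 S₀ q hq' (fun _ b ↦ hq' _ b) hc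
  · -- the preimage in `H¹(H, A)` lies in `R(A)`
    exact hA.subset (preimage_datumStrictSelmer_subset H p 𝔭 S₀ j hj' hU hS)

/-- **The same with (U) and (S) discharged by §1**: (U) from «`I_v` acts trivially on `B` at every `v ∉ Σ`,
`v ∤ p`» (unramified coefficients — e.g. `B = E[p]` and `Σ ⊇` bad places) and (S) from «`C` has no non-zero
vector fixed by `H ⊓ D_𝔭`» (on the Leopoldt cell with `C = 𝔽₃(ψ)`: `ψ` non-trivial on `G_{K_{∞,𝔭′}}`, the
non-anomalous clause). [cite: CastellaGrossiLeeSkinner2022, Prop. 17 (arXiv:2008.02571 §1.4), hypothesis φ|_{G_p} ≠ 1, ω] -/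
theorem finite_datumStrictSelmer_of_devissage_of_unramified_of_fixed (j : A →+ B)
    (hj' : ∀ (σ : absoluteGaloisGroup K) (a : A), j (σ • a) = σ • j a) (hinj : Function.Injective j)
    (q : B →+ C) (hq' : ∀ (σ : absoluteGaloisGroup K) (b : B), q (σ • b) = σ • q b)
    (hqj : ∀ a : A, q (j a) = 0) (hsurj : Function.Surjective q)
    (hexact : ∀ b : B, q b = 0 → ∃ a : A, j a = b)
    (hcontB : ∀ b : B, Continuous fun g : absoluteGaloisGroup K ↦ g • b)
    (hunr : ∀ v : HeightOneSpectrum (𝓞 K), v ∉ S₀ → ((p : ℕ) : 𝓞 K) ∉ v.asIdeal →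
      ∀ (τ : inertiaIn H v) (b : B), τ • b = b)
    (hfix : ∀ c : C, (∀ g : ↥(H ⊓ decomp 𝔭), g • c = c) → c = 0)
    (hA : (datumStrictSelmer H A p (AcSelmer.bdpData A p 𝔭) S₀ : Set (subgroupH1 H A)).Finite)
    (hC : (datumStrictSelmer H C p (AcSelmer.bdpData C p 𝔭) S₀ : Set (subgroupH1 H C)).Finite) :
    (datumStrictSelmer H B p (AcSelmer.bdpData B p 𝔭) S₀ : Set (subgroupH1 H B)).Finite := by
  refine finite_datumStrictSelmer_of_devissage H p 𝔭 S₀ j hj' hinj q hq' hsurj hexact hcontB ?_ ?_ hA hC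
  · intro v hvS hvp
    exact resH1Hom_id_injective_of_smul_eq (G := ↥(inertiaIn H v)) j (fun _ a ↦ hj' _ a) hinj
      (hunr v hvS hvp)
  · exact resH1Hom_id_injective_of_forall_fixed_eq_zero (G := ↥(H ⊓ decomp 𝔭)) j (fun _ a ↦ hj' _ a)
      hinj q (fun _ b ↦ hq' _ b) hqj hexact hfix

end Residual

end Summit.BirchSwinnertonDyer.BirchSwinnertonDyer.Theorems.CumulativeHeegnerInclusionAtThreeStubB1DevissageNamed

end
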